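import Summits.CriticalPhenomena.PercolationContinuityZ3.Theorems.PercNearOneGluingNoHeavyQuantLightSliceKnapsack
import Summits.CriticalPhenomena.PercolationContinuityZ3.Theorems.PercNearOneGluingNoHeavyQuantCrossGiantCellReal
import Summits.CriticalPhenomena.PercolationContinuityZ3.Theorems.PercNearOneGluingNoHeavyQuantLightTwoBlobFlow
import Summits.CriticalPhenomena.PercolationContinuityZ3.Theorems.PercNearOneGluingNoHeavyQuantAtomLightSlice
import HarnessLib

/-!
# QUANT lane R8, T-DEC: **THE CROSSED TYPE II LOW-CROSS CLASS WITH THE LOWER CROSS CELL A GIANT IS DEC** — the first pooled class of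
# `LightSliceLowCross` closed in the kernel (census-2 g59)

builds on p205010 (kernel theorem, internal audit signed; external expert review pending)

Support file (`--supports stmt-CriticalPhenomena-4575`), QUANT lane seat prim-quant-census-2 (gen 59), rung R8 of
`run/shared/lean/prim/quant/LADDER.md`.  Memo `run/shared/lean/prim/quant/prim-quant-census-2-g59/ASSEMBLY-G59.md` §5.  Theorems only,
standard axioms, no sorries, no definitions.

* **`LawDec.lightSlice_decAtT_lowCross_crossGiant`** — floor `0 < x < 1`; side 1's light credit pair `{p, m}` at target `T₁` (`2p < T₁ < p + m`,
  `m ≤ j`, `m ≤ M₁`, usage `< u`); side 2's admissible atom `(l, h; l′, h′)` at `T₂` (`AtomData`, ordered `l < l′`, `h′ ≤ h`); the residue geometry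
  of `LightSliceLowCross`: deep `p + h′ ≤ j`, ¬A2 `T₁ + T₂ ≤ 2(p + h′)`, top giant `j + 1 ≤ m + h′`, LOW CROSS `2(m + l′) < T₁ + T₂`, and the
  lower cross cell of the expensive piece a GIANT `j + 1 ≤ p + h` (crossed Type II).  Then the light slice
  `lconv M₁ M₂ (TP[p, m; gateOf x T₁ j p m]) (atomLaw x T₂ j l h l′ h′)` is `DECAtT x (T₁ + T₂) j (M₁ + M₂)`.
PROOF.  `lightSlice_decAtT_crossGiant_of_knapsack` (the single-mid knapsack form with the mid `p + h′`) + the balance identity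
`m_E c₁ + m_C c₂ = u(m_E + m_C)` + `CrossGiantCell.twoTerm_knapsack` / `budget_S` (only the `M2 = m + l′` and `P2 = p + l′` terms are used;
`M2 → p + h′` is always LIGHT) + `CrossGiantCell.star_of_rates` ((★), through the 25-term certificate (★★)) + `half_le_gamma_of_incompatible`.
The rates: `r = (T₁ − 2p)/(m − p)`, `ρ_c = (T₂ − 2l′)/(h′ − l′)`, `a = (m − p)/(h′ − l′)`, `P = ρ_c + ra` (rate of `P2 → p+h′`), `M = (P − 2a)/(1 − a)`
(rate of `M2 → p+h′`); usages in closed form by typer g22's `usage_eq_light'` / `usage_eq_heavy'`.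
EXACT CENSUS: this class has 4 872 instances at M ≤ 7 and 30 036 at M ≤ 8 (kit j161991 / j162002; 963 resp. 8 132 of them NOT piece-wise);
the reduced 6-variable region scan (180 000 exact samples) and the embedded instances have 0 failures (kit j163808).

[this work]; certificate engine census-1 g20 (this lane).  The gluing rows served [cite: KozmaNitzan2024, Conjecture 3 (p. 15)]; product measure
[cite: Grimmett1999, §1.3 p. 10].
-/

noncomputable section

namespace Summit.CriticalPhenomena.PercolationContinuityZ3.Theorems

namespace Quant

open Finset

/-- the two-point law `{lo, hi; g}` (as in `…QuantLawDEC`) -/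
local notation3 "TP[" lo ", " hi ", " g ", " h "]" =>
  (g : ℝ) * (if (h : ℕ) = (hi : ℕ) then (1 : ℝ) else 0) + (1 - (g : ℝ)) * (if (h : ℕ) = (lo : ℕ) then (1 : ℝ) else 0)

namespace LawDec

/-- a pair with rate `ρ ≤ x` has the light usage `U_ℓ(ρ) = (x² + (1−x)ρ)/((1−x)(1+x−ρ))`. -/
theorem usage_eq_Ul (x T : ℝ) (j lo hi : ℕ) (ρ : ℝ) (hx0 : 0 < x) (hx1 : x < 1) (hhi : hi ≤ j) (hlow : 2 * (lo : ℝ) < T)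
    (hcomp : T < (lo : ℝ) + hi) (hρ : ρ * ((hi : ℝ) - lo) = T - 2 * (lo : ℝ)) (hρx : ρ ≤ x) :
    usage x T j lo hi = (x ^ 2 + (1 - x) * ρ) / ((1 - x) * (1 + x - ρ)) := by
  have hd : (0 : ℝ) < (hi : ℝ) - lo := by linarith
  rw [usage_eq_light' x T j lo hi hx0 hx1 hhi hlow hcomp (by rw [← hρ]; nlinarith)]
  have h1 : (1 - x) * ((1 - x) * (lo : ℝ) + (1 + x) * hi - T) = ((1 - x) * (1 + x - ρ)) * ((hi : ℝ) - lo) := by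
    linear_combination (1 - x) * hρ
  have h2 : x ^ 2 * ((hi : ℝ) - lo) + (1 - x) * (T - 2 * (lo : ℝ)) = (x ^ 2 + (1 - x) * ρ) * ((hi : ℝ) - lo) := by
    linear_combination (-(1 - x)) * hρ
  rw [h1, h2, mul_div_mul_right _ _ hd.ne']

/-- a pair with rate `ρ ≥ x` has the heavy usage `ρ/(1−ρ)`. -/
theorem usage_eq_Uh (x T : ℝ) (j lo hi : ℕ) (ρ : ℝ) (hx0 : 0 < x) (hx1 : x < 1) (hhi : hi ≤ j) (hlow : 2 * (lo : ℝ) < T)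
    (hcomp : T < (lo : ℝ) + hi) (hρ : ρ * ((hi : ℝ) - lo) = T - 2 * (lo : ℝ)) (hxρ : x ≤ ρ) :
    usage x T j lo hi = ρ / (1 - ρ) := by
  have hd : (0 : ℝ) < (hi : ℝ) - lo := by linarith
  rw [usage_eq_heavy' x T j lo hi hx0 hx1 hhi hlow hcomp (by rw [← hρ]; nlinarith)]
  have h1 : (lo : ℝ) + hi - T = (1 - ρ) * ((hi : ℝ) - lo) := by linear_combination hρ
  rw [h1, ← hρ, mul_div_mul_right _ _ hd.ne']

/-- the rate of a LIGHT compatible pair is below `x`. -/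
theorem rate_lt_of_usage_lt (x T : ℝ) (j lo hi : ℕ) (ρ : ℝ) (hx1 : x < 1) (hhi : hi ≤ j) (hd : (0 : ℝ) < (hi : ℝ) - lo)
    (hρ : ρ * ((hi : ℝ) - lo) = T - 2 * (lo : ℝ)) (hg1 : gateOf x T j lo hi < 1) (hu : usage x T j lo hi < x / (1 - x)) : ρ < x := by
  have hgx := gate_lt_of_usage_lt x T j lo hi hx1 hg1 hu
  rw [gateOf_of_le x T j lo hi hhi] at hgx
  have : (T - 2 * (lo : ℝ)) / ((hi : ℝ) - lo) = ρ := by rw [div_eq_iff hd.ne', hρ]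
  have h := lt_of_le_of_lt (le_max_left _ _) hgx
  rwa [this] at h

set_option maxHeartbeats 1600000 in
/-- **THE CROSSED TYPE II LOW-CROSS CLASS WITH THE LOWER CROSS CELL A GIANT IS DEC.**  See the module docstring. [this work] -/
theorem lightSlice_decAtT_lowCross_crossGiant (x T₁ T₂ : ℝ) (M₁ M₂ j p m l h l' h' : ℕ) (hx0 : 0 < x) (hx1 : x < 1)
    (hlow₁ : 2 * (p : ℝ) < T₁) (hmj : m ≤ j) (hmM : m ≤ M₁) (hc₁ : T₁ < (p : ℝ) + m) (hlight₁ : usage x T₁ j p m < x / (1 - x))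
    (hd₂ : AtomData x T₂ j M₂ l h l' h') (hll' : l < l') (hh'h : h' ≤ h)
    (hdeep : p + h' ≤ j) (hA2 : T₁ + T₂ ≤ 2 * ((p : ℝ) + h')) (htop : j + 1 ≤ m + h') (hlow : 2 * ((m : ℝ) + l') < T₁ + T₂)
    (hcg : j + 1 ≤ p + h) :
    DECAtT x (T₁ + T₂) j (M₁ + M₂) (lconv M₁ M₂ (fun b => TP[p, m, gateOf x T₁ j p m, b]) (atomLaw x T₂ j l h l' h')) := by
  classical
  obtain ⟨-, hl'h'⟩ := hd₂.lt_of
  obtain ⟨-, -, -, a4, -, -, b2, b3, -, b5, -, c2, c1⟩ := hd₂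
  have hpm' : (p : ℝ) < m := by linarith
  have hpm : p < m := by exact_mod_cast hpm'
  have hlh'' : (l' : ℝ) < h' := by exact_mod_cast hl'h'
  have h1x : 0 < 1 - x := by linarith
  have hu0 : 0 < x / (1 - x) := div_pos hx0 h1x
  obtain ⟨hγx2, hγ1⟩ := gateOf_bounds x T₁ j p m hx0 hx1 hlow₁ hmj hc₁
  have hγx : gateOf x T₁ j p m < x := gate_lt_of_usage_lt x T₁ j p m hx1 hγ1 hlight₁
  have hγ0 : 0 ≤ gateOf x T₁ j p m := by nlinarith
  have hc₂0 : 0 ≤ usage x T₂ j l' h' := (usage_pos_of_compat x T₂ j l' h' hx0 hx1 b2 hl'h' (Or.inr b5)).le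
  -- spans and rates
  have hA0 : (0 : ℝ) < (m : ℝ) - p := by linarith
  have hB0 : (0 : ℝ) < (h' : ℝ) - l' := by linarith
  obtain ⟨r, hr⟩ : ∃ r : ℝ, r = (T₁ - 2 * (p : ℝ)) / ((m : ℝ) - p) := ⟨_, rfl⟩
  obtain ⟨ρc, hρc⟩ : ∃ ρc : ℝ, ρc = (T₂ - 2 * (l' : ℝ)) / ((h' : ℝ) - l') := ⟨_, rfl⟩
  obtain ⟨a, ha⟩ : ∃ a : ℝ, a = ((m : ℝ) - p) / ((h' : ℝ) - l') := ⟨_, rfl⟩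
  have hrA : r * ((m : ℝ) - p) = T₁ - 2 * (p : ℝ) := by rw [hr]; field_simp
  have hρB : ρc * ((h' : ℝ) - l') = T₂ - 2 * (l' : ℝ) := by rw [hρc]; field_simp
  have haB : a * ((h' : ℝ) - l') = (m : ℝ) - p := by rw [ha]; field_simp
  have hr0 : 0 ≤ r := by rw [hr]; exact div_nonneg (by linarith) hA0.le
  have hrx : r < x := rate_lt_of_usage_lt x T₁ j p m r hx1 hmj hA0 hrA hγ1 hlight₁
  obtain ⟨-, hg2'⟩ := gateOf_bounds x T₂ j l' h' hx0 hx1 b2 b3 b5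
  have hρcx : ρc < x := rate_lt_of_usage_lt x T₂ j l' h' ρc hx1 b3 hB0 hρB hg2' c2
  have hρc0 : 0 ≤ ρc := by rw [hρc]; exact div_nonneg (by linarith) hB0.le
  have ha0 : 0 < a := by rw [ha]; exact div_pos hA0 hB0
  -- low cross in the rates: (2 - r) a < ρc  (from 2(m + l') < T₁ + T₂)
  have hraB : r * (a * ((h' : ℝ) - l')) = r * ((m : ℝ) - p) := by rw [haB]
  have hlc : (2 - r) * a < ρc := by
    have key : ((2 - r) * a) * ((h' : ℝ) - l') < ρc * ((h' : ℝ) - l') := by linarith [hraB, hrA, hρB, haB]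
    exact lt_of_mul_lt_mul_right key hB0.le
  have ha1 : a < 1 := by nlinarith
  have h1a : 0 < 1 - a := by linarith
  -- γ and c₂ in the rates
  have hγ : gateOf x T₁ j p m = x ^ 2 + (1 - x) * r := by
    rw [gateOf_of_le x T₁ j p m hmj, pairGate_eq_light x T₁ p m hx0.le (by rw [← hr]; exact hrx.le), ← hr]
  have hc₂ : usage x T₂ j l' h' = (x ^ 2 + (1 - x) * ρc) / ((1 - x) * (1 + x - ρc)) :=
    usage_eq_Ul x T₂ j l' h' ρc hx0 hx1 b3 b2 b5 hρB hρcx.le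
  have hc₂u : usage x T₂ j l' h' ≤ x / (1 - x) := by rw [hc₂]; exact CrossGiantCell.Ul_le_u x ρc hx0 hx1 hρcx.le
  -- the rates of the cross pairs P2 = p + l' and M2 = m + l' into the mid p + h'
  obtain ⟨P, hP⟩ : ∃ P : ℝ, P = ρc + r * a := ⟨_, rfl⟩
  obtain ⟨M, hM⟩ : ∃ M : ℝ, M = (P - 2 * a) / (1 - a) := ⟨_, rfl⟩
  have hPB : P * ((h' : ℝ) - l') = (T₁ + T₂) - 2 * ((p : ℝ) + l') := by
    rw [hP]; linarith [hraB, hrA, hρB]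
  have hMB : M * ((1 - a) * ((h' : ℝ) - l')) = (T₁ + T₂) - 2 * ((m : ℝ) + l') := by
    have e : M * ((1 - a) * ((h' : ℝ) - l')) = (P - 2 * a) * ((h' : ℝ) - l') := by
      rw [hM]; field_simp
    rw [e]; linarith [hPB, haB]
  have hPspan : P * ((((p + h' : ℕ) : ℝ)) - ((p + l' : ℕ) : ℝ)) = (T₁ + T₂) - 2 * (((p + l' : ℕ) : ℝ)) := by
    push_cast
    have e : ((p : ℝ) + h' - ((p : ℝ) + l')) = (h' : ℝ) - l' := by ring
    rw [e, hPB]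
  have hMspan : M * ((((p + h' : ℕ) : ℝ)) - ((m + l' : ℕ) : ℝ)) = (T₁ + T₂) - 2 * (((m + l' : ℕ) : ℝ)) := by
    push_cast
    have e : ((p : ℝ) + h' - ((m : ℝ) + l')) = (1 - a) * ((h' : ℝ) - l') := by linarith [haB]
    rw [e, hMB]
  have hMx : M < x := by
    rw [hM, div_lt_iff₀ h1a]
    have : P - x < r * a := by rw [hP]; linarith
    nlinarith [mul_pos ha0 h1x]
  have hdM : (0 : ℝ) < ((p + h' : ℕ) : ℝ) - ((m + l' : ℕ) : ℝ) := by push_cast; linarith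
  have hcompM : T₁ + T₂ < ((m + l' : ℕ) : ℝ) + ((p + h' : ℕ) : ℝ) := by push_cast; linarith
  have hlowM : 2 * (((m + l' : ℕ) : ℝ)) < T₁ + T₂ := by push_cast; exact hlow
  have hM2 : usage x (T₁ + T₂) j (m + l') (p + h') = (x ^ 2 + (1 - x) * M) / ((1 - x) * (1 + x - M)) :=
    usage_eq_Ul x (T₁ + T₂) j (m + l') (p + h') M hx0 hx1 hdeep hlowM hcompM hMspan hMx.le
  have hM2u : usage x (T₁ + T₂) j (m + l') (p + h') ≤ x / (1 - x) := by
    rw [hM2]; exact CrossGiantCell.Ul_le_u x M hx0 hx1 hMx.le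
  -- P2 incompatible forces γ ≥ 1/2; P2 heavy-compatible gives (★)
  have hincγ : ¬ (T₁ + T₂ < ((p : ℝ) + l') + ((p : ℝ) + h')) → 1 / 2 ≤ gateOf x T₁ j p m := by
    intro hnc
    push Not at hnc
    have hP1 : 1 ≤ P := by
      have : 1 * ((h' : ℝ) - l') ≤ P * ((h' : ℝ) - l') := by rw [hPB]; linarith
      exact le_of_mul_le_mul_right this hB0
    rw [hγ]
    exact CrossGiantCell.half_le_gamma_of_incompatible x r ρc a hx1 hr0 hrx hρcx hlc (by rw [← hP]; exact hP1)
  have hstar : (T₁ + T₂ < ((p : ℝ) + l') + ((p : ℝ) + h')) → x / (1 - x) ≤ usage x (T₁ + T₂) j (p + l') (p + h') →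
      (1 - gateOf x T₁ j p m) * usage x T₂ j l' h' * (usage x (T₁ + T₂) j (p + l') (p + h') - x / (1 - x))
        ≤ x / (1 - x) * gateOf x T₁ j p m * (usage x (T₁ + T₂) j (p + l') (p + h') - usage x (T₁ + T₂) j (m + l') (p + h')) := by
    intro hc hheavy
    have hcompP : T₁ + T₂ < ((p + l' : ℕ) : ℝ) + ((p + h' : ℕ) : ℝ) := by push_cast; exact hc
    have hlowP : 2 * (((p + l' : ℕ) : ℝ)) < T₁ + T₂ := by push_cast; linarith
    have hdP : (0 : ℝ) < ((p + h' : ℕ) : ℝ) - ((p + l' : ℕ) : ℝ) := by push_cast; linarith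
    have hP1 : P < 1 := by
      have : P * ((h' : ℝ) - l') < 1 * ((h' : ℝ) - l') := by rw [hPB]; linarith
      exact lt_of_mul_lt_mul_right this hB0.le
    have hg1P : gateOf x (T₁ + T₂) j (p + l') (p + h') < 1 :=
      (gateOf_bounds x (T₁ + T₂) j (p + l') (p + h') hx0 hx1 hlowP hdeep hcompP).2
    -- heavy: `x ≤ P`
    have hPx : x ≤ P := by
      by_contra hlt
      push Not at hlt
      have hUl := usage_eq_Ul x (T₁ + T₂) j (p + l') (p + h') P hx0 hx1 hdeep hlowP hcompP hPspan hlt.le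
      have hlt' : usage x (T₁ + T₂) j (p + l') (p + h') < x / (1 - x) := by
        rw [hUl, div_lt_div_iff₀ (mul_pos h1x (by linarith)) h1x]
        nlinarith [mul_pos h1x (by linarith : 0 < x - P)]
      linarith
    have hcP : usage x (T₁ + T₂) j (p + l') (p + h') = P / (1 - P) :=
      usage_eq_Uh x (T₁ + T₂) j (p + l') (p + h') P hx0 hx1 hdeep hlowP hcompP hPspan hPx
    rw [hcP, hM2]
    exact CrossGiantCell.star_of_rates x r ρc a P M (gateOf x T₁ j p m) (x / (1 - x)) (usage x T₂ j l' h') _ _ hx0 hx1 hr0 hrx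
      hρc0 hρcx ha0 hlc hP hPx hP1 hM hγ rfl hc₂ rfl rfl
  -- masses and the balance identity of the atom
  have hK : 0 < (1 - x) / (usage x T₂ j l h - usage x T₂ j l' h') := div_pos h1x (by linarith [c2.trans c1])
  obtain ⟨mE, hmEdef⟩ : ∃ mE : ℝ, mE = (1 - x) / (usage x T₂ j l h - usage x T₂ j l' h') * (x / (1 - x) - usage x T₂ j l' h') := ⟨_, rfl⟩
  obtain ⟨mC, hmCdef⟩ : ∃ mC : ℝ, mC = (1 - x) / (usage x T₂ j l h - usage x T₂ j l' h') * (usage x T₂ j l h - x / (1 - x)) := ⟨_, rfl⟩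
  have hmE : 0 ≤ mE := by rw [hmEdef]; exact mul_nonneg hK.le (by linarith [c2])
  have hmC : 0 < mC := by rw [hmCdef]; exact mul_pos hK (by linarith [c1])
  have hbal : mE * usage x T₂ j l h + mC * usage x T₂ j l' h' = x / (1 - x) * (mE + mC) := by
    rw [hmEdef, hmCdef]; ring
  have hM2compat : T₁ + T₂ < ((m : ℝ) + l') + ((p : ℝ) + h') := by push_cast at hcompM; linarith
  have hbelow : m + l' < p + h' := by
    have : ((m : ℝ) + l') < (p : ℝ) + h' := by linarith
    exact_mod_cast this
  refine lightSlice_decAtT_crossGiant_of_knapsack x (T₁ + T₂) T₂ (gateOf x T₁ j p m) M₁ M₂ j p m l h l' h' hx0 hx1 hγ0 hγ1.le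
    hc₂0 c2 c1 hpm hll' hh'h hmM a4 hdeep hA2 hlow hbelow hcg htop ?_ ?_
  · -- the incompatible budget
    rw [← hmEdef, ← hmCdef, if_pos hM2compat, add_zero]
    have hS := CrossGiantCell.budget_S (x / (1 - x)) (gateOf x T₁ j p m) (usage x T₂ j l' h')
      (T₁ + T₂ < ((p : ℝ) + l') + ((p : ℝ) + h')) hu0 hγ0 hγ1.le hc₂0 hc₂u hincγ
    have t1 : x / (1 - x) * (if T₁ + T₂ < ((p : ℝ) + l) + ((p : ℝ) + h') then (0 : ℝ) else (1 - gateOf x T₁ j p m) * mE)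
        ≤ x / (1 - x) * ((1 - gateOf x T₁ j p m) * mE) := by
      refine mul_le_mul_of_nonneg_left ?_ hu0.le
      split_ifs
      · exact mul_nonneg (by linarith) hmE
      · exact le_rfl
    have t3 : x / (1 - x) * (if T₁ + T₂ < ((m : ℝ) + l) + ((p : ℝ) + h') then (0 : ℝ) else gateOf x T₁ j p m * mE)
        ≤ x / (1 - x) * (gateOf x T₁ j p m * mE) := by
      refine mul_le_mul_of_nonneg_left ?_ hu0.le
      split_ifs
      · exact mul_nonneg hγ0 hmE
      · exact le_rfl
    have t2 : x / (1 - x) * (if T₁ + T₂ < ((p : ℝ) + l') + ((p : ℝ) + h') then (0 : ℝ) else (1 - gateOf x T₁ j p m) * mC)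
        + (1 - gateOf x T₁ j p m) * mC * usage x T₂ j l' h' ≤ x / (1 - x) * mC := by
      have hS' := mul_le_mul_of_nonneg_left hS hmC.le
      by_cases hc : T₁ + T₂ < ((p : ℝ) + l') + ((p : ℝ) + h')
      · rw [if_pos hc]; rw [if_pos hc] at hS'
        linarith only [hS']
      · rw [if_neg hc]; rw [if_neg hc] at hS'
        linarith only [hS']
    linarith only [t1, t2, t3, hbal]
  · intro θ hθ
    rw [← hmEdef, ← hmCdef, if_pos hM2compat]
    have hK2 := CrossGiantCell.twoTerm_knapsack (x / (1 - x)) (gateOf x T₁ j p m) (usage x T₂ j l' h')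
      (usage x (T₁ + T₂) j (m + l') (p + h')) (usage x (T₁ + T₂) j (p + l') (p + h'))
      (T₁ + T₂ < ((p : ℝ) + l') + ((p : ℝ) + h')) hu0 hγ0 hγ1.le hc₂0 hc₂u hM2u hstar hincγ θ
    have f1 : (if T₁ + T₂ < ((p : ℝ) + l) + ((p : ℝ) + h') then min (usage x (T₁ + T₂) j (p + l) (p + h')) θ else θ) ≤ θ := by
      split_ifs; exacts [min_le_right _ _, le_rfl]
    have f3 : (if T₁ + T₂ < ((m : ℝ) + l) + ((p : ℝ) + h') then min (usage x (T₁ + T₂) j (m + l) (p + h')) θ else θ) ≤ θ := by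
      split_ifs; exacts [min_le_right _ _, le_rfl]
    have g1 := mul_le_mul_of_nonneg_left f1 (mul_nonneg (by linarith : 0 ≤ 1 - gateOf x T₁ j p m) hmE)
    have g3 := mul_le_mul_of_nonneg_left f3 (mul_nonneg hγ0 hmE)
    have g2 := mul_le_mul_of_nonneg_left hK2 hmC.le
    have eθ : θ * ((1 - x) / x) * ((1 - gateOf x T₁ j p m) * mE * usage x T₂ j l h + gateOf x T₁ j p m * mE * usage x T₂ j l h
          + gateOf x T₁ j p m * mC * usage x T₂ j l' h')
        = θ * (mE + mC) - (1 - gateOf x T₁ j p m) * mC * usage x T₂ j l' h' * (θ / (x / (1 - x))) := by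
      have hx0' : x ≠ 0 := hx0.ne'
      have h1x' : (1 : ℝ) - x ≠ 0 := h1x.ne'
      have e1 : mE * usage x T₂ j l h = x / (1 - x) * (mE + mC) - mC * usage x T₂ j l' h' := by linarith [hbal]
      rw [show (1 - gateOf x T₁ j p m) * mE * usage x T₂ j l h + gateOf x T₁ j p m * mE * usage x T₂ j l h
          = mE * usage x T₂ j l h by ring, e1]
      field_simp
      ring
    linarith only [g1, g2, g3, eθ]

end LawDec

end Quant

end Summit.CriticalPhenomena.PercolationContinuityZ3.Theorems
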